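import Literature.NumberTheory.EllipticCurves.IwasawaTowerTorsionOrdinaryProofs
import Literature.NumberTheory.EllipticCurves.GeomReductionFrobeniusProofs
import Literature.NumberTheory.EllipticCurves.FrobeniusEndomorphism
import Literature.NumberTheory.EllipticCurves.GreenbergSelmer
import Literature.NumberTheory.GaloisRepresentations.DecompositionGroupOfCompletion
import Literature.NumberTheory.GaloisRepresentations.IntegralGaloisActionProofs
import HarnessLib

/-!
# `E(ℚ_{p,∞})[p^∞]` is finite for a good ordinary prime `p` and the cyclotomic `ℤ_p`-extension
# (Imai 1975 / Mazur 1972 Prop. 6.12, LOCAL form; Greenberg LNM 1716 §1 p. 62, §3 p. 86)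

`Proofs` file (theorems only; no definition, no named fact) in topic `NumberTheory/EllipticCurves`, the
LOCAL companion of `IwasawaTowerTorsionOrdinaryProofs.lean` (which proves `E(ℚ_∞)[p^∞] = E(ℚ)[p^∞]`,
finite, for the GLOBAL group `Gal(ℚ̄/ℚ_∞) = ker κ`).  Kato's comparison of his `𝐇²_Γ(T_pW)` with the dual
fine Selmer group ([Ka] (14.9.1) + (17.13.1), tree named fact
`Kato2004.exists_iwasawaH2Data_fineSelmerDual_embedding`) carries the hypothesis
`Finite (E[p^∞]^{ker κ ⊓ D_v})` — the `p`-power torsion of `E` rational over the completion `ℚ_{p,∞}`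
of the cyclotomic tower at the place above `p` (`D_v = GreenbergSelmer.decomp v`, the decomposition
group of the tree's chosen prime `adicCompletionPrime ℚ v` above `v`), i.e. Imai's theorem [Im]
(`A(k(μ_{p^∞}))_{tors}` is finite for an abelian variety with good reduction over a `p`-adic field `k`)
for `E/ℚ_p` and the cyclotomic `ℤ_p`-extension.  This file proves it at a good ORDINARY odd prime
`p`, by the argument of the global file run inside the decomposition group:

* `smul_mem_fixedPoints_kerSubgroup_inf` — `B_D = E[p^∞]^{ker κ ⊓ D}` is `D`-stable;
* `eq_zero_of_mem_fixedPoints_kerSubgroup_inf_of_geomReduction_eq_zero` — **`B_D ∩ ker(red) = 0`**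
  for `D = D_𝔓` the decomposition group of the prime `𝔓` of `\bar ℤ` cut out by the place
  `placeOver p` and the CYCLOTOMIC `κ`: steps (i)–(iv) of the global file — the ordinary line
  `X = 𝔽_p v₀ = ker(red) ∩ E[p]` (Serre 1972 §1.11), an inertia element `τ₀` acting on `v₀` by `-1`,
  and `v₀ ∉ B_D` because some `p`-power of `τ₀` acts trivially on the finite `D`-stable group
  `B_D[p]`: all of `D` acts on it through a finite group of exponent `d = pᵃ·e`, and
  `κ(τ₀^{pᵃ}) = κ(g^d)` for some `g ∈ I_𝔓` (**`κ(I_𝔓) = ℤ_p`**, total ramification of `ℚ_∞/ℚ` at `p`,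
  `ZpExtension.IsCyclotomic.exists_mem_inertia_apply_eq`), so `τ₀^{pᵃ} ∈ g^d · (ker κ ⊓ D)`;
* `smul_eq_of_mem_inertia_of_mem_fixedPoints_kerSubgroup_inf`,
  `smul_eq_of_mem_decompositionSubgroup_of_mem_fixedPoints_kerSubgroup_inf` — hence `I_𝔓`, and then
  all of `D_𝔓 = I_𝔓 · (ker κ ⊓ D_𝔓)`, act trivially on `B_{D_𝔓}` (step (v));
* `finite_fixedPoints_kerSubgroup_inf_decompositionSubgroup_of_ordinary` — **`B_{D_𝔓}` is finite**
  for EVERY prime `𝔓 ∣ p` of `\bar ℤ`: for the place's prime, `red` is injective on `B_D` and, `B_D`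
  being fixed by an arithmetic Frobenius `σ ∈ D_𝔓`, lands in the `p`-power-Frobenius-fixed points of
  `Ẽ(𝔽̄_p)` (`geomReduction_smul_of_isArithFrobAt`), a finite set (`finite_setOf_frobenius_smul_eq`:
  `Ẽ(𝔽_p)` is finite); any other prime above `p` is a conjugate `g • 𝔓`
  (`exists_smul_eq_of_mem_primesAbove_holds`), `D_{g•𝔓} = g D_𝔓 g⁻¹`, and `b ↦ g⁻¹ • b` is an injection
  `B_{D_{g•𝔓}} ↪ B_{D_𝔓}`;
* `finite_fixedPoints_kerSubgroup_inf_decomp_of_ordinary` — the hypothesis of the `𝐇²` comparison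
  VERBATIM: `Finite (FixedPoints.addSubgroup ↥(κ.kerSubgroup ⊓ GreenbergSelmer.decomp v) (W.geomPrimaryTorsion p))`
  for `p` odd good ordinary, `κ` cyclotomic, `v` the place at `p`
  (`decomp v = D_{adicCompletionPrime ℚ v}`, `decompositionSubgroup_adicCompletionPrime_eq_range`).

## References
* [GreenbergLNM1716] R. Greenberg, *Iwasawa theory for elliptic curves*, LNM 1716 (1999), §1 p. 62
  ("The crucial step is to show that `E(F_∞)_{tors}` is finite … See also [Im] or [Ri]"), §3 p. 86.
* [Imai1975] H. Imai, *A remark on the rational points of abelian varieties with values in cyclotomic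
  `ℤ_p`-extensions*, Proc. Japan Acad. 51 (1975) 12–16, Theorem (p. 12).
* [Serre1972] J.-P. Serre, Invent. Math. 15 (1972) 259–331, §1.11 Prop. 11 and Cor.
* [Washington1997] L. C. Washington, *Introduction to Cyclotomic Fields*, 2nd ed., §13.1.
* Tree: `IwasawaTowerTorsionOrdinaryProofs.lean` (global version and the total-ramification bricks),
  `SerreOpenImageOrdinaryInertiaProofs.lean`, `SerreOpenImageReductionInertiaProofs.lean`,
  `GeomReductionFrobeniusProofs.lean`, `FrobeniusEndomorphism.lean`, `GreenbergSelmer.lean`.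
-/

noncomputable section

open scoped Classical NumberField Pointwise
open IsDedekindDomain Field

universe u

namespace WeierstrassCurve

open Literature.NumberTheory.EllipticCurves Literature.NumberTheory.GaloisRepresentations
  Rat.HeightOneSpectrum Literature.NumberTheory.EllipticCurves.IwasawaDual
open scoped AddSubgroup

variable (W : WeierstrassCurve ℚ) [W.IsElliptic] [W.IsGloballyMinimal] {p : ℕ} [Fact p.Prime]
  (κ : ZpExtension ℚ p)

/-! ## §1 `B_D = E[p^∞]^{ker κ ⊓ D}` is `D`-stable -/

omit [W.IsElliptic] [W.IsGloballyMinimal] in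
/-- `B_D = E[p^∞]^{ker κ ⊓ D}` is stable under `D` (`ker κ` is normal in `Γ_ℚ`).
[cite: GreenbergLNM1716, §1 p. 62] -/
theorem smul_mem_fixedPoints_kerSubgroup_inf {D : Subgroup (absoluteGaloisGroup ℚ)}
    {σ : absoluteGaloisGroup ℚ} (hσ : σ ∈ D) {m : geomPrimaryTorsion W p}
    (hm : m ∈ FixedPoints.addSubgroup ↥(κ.kerSubgroup ⊓ D) (geomPrimaryTorsion W p)) :
    σ • m ∈ FixedPoints.addSubgroup ↥(κ.kerSubgroup ⊓ D) (geomPrimaryTorsion W p) := by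
  rw [FixedPoints.mem_addSubgroup] at hm ⊢
  rintro ⟨τ, hτ⟩
  have hτK : τ ∈ κ.kerSubgroup := (Subgroup.mem_inf.mp hτ).1
  have hτD : τ ∈ D := (Subgroup.mem_inf.mp hτ).2
  have hconj : σ⁻¹ * τ * σ ∈ κ.kerSubgroup ⊓ D := by
    refine Subgroup.mem_inf.mpr ⟨?_, D.mul_mem (D.mul_mem (D.inv_mem hσ) hτD) hσ⟩
    rw [ZpExtension.mem_kerSubgroup] at hτK ⊢
    rw [map_mul, map_mul, map_inv, hτK, mul_one, inv_mul_cancel]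
  have h := hm ⟨σ⁻¹ * τ * σ, hconj⟩
  rw [Subgroup.mk_smul] at h ⊢
  calc τ • σ • m = σ • ((σ⁻¹ * τ * σ) • m) := by
        rw [mul_smul, mul_smul, smul_inv_smul]
    _ = σ • m := by rw [h]

/-! ## §2 `B_D ∩ ker(red) = 0` at the place's prime, for the cyclotomic tower -/

/-- **`B_D ∩ ker(red) = 0`** for `D = D_𝔓` the decomposition group of the prime `𝔓` of the place
`placeOver p` and the CYCLOTOMIC `κ`, `p` odd with `p ∤ Δ_W`, `p ∤ a_p`: a point of
`B_D = E[p^∞]^{ker κ ⊓ D_𝔓}` in the kernel of the reduction `red : E(ℚ̄) → Ẽ(𝔽̄_p)` is zero. Steps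
(i)–(iv) of `smul_eq_of_mem_inertia_of_mem_fixedPoints_kerSubgroup` (the global file), with the
`p`-group step replaced by: `D_𝔓` acts on the finite group `B_D[p]` through a finite group of exponent
`d = pᵃ e`, `p ∤ e`, and `κ(τ₀^{pᵃ}) = κ(g^d)` for some `g ∈ I_𝔓 ≤ D_𝔓` (`κ(I_𝔓) = ℤ_p`), so `τ₀^{pᵃ}`
fixes `B_D[p]`. [cite: GreenbergLNM1716, §1 p. 62; §3 p. 86] [cite: Serre1972, §1.11 Prop. 11 and Cor.]
[cite: Washington1997, §13.1] -/
theorem eq_zero_of_mem_fixedPoints_kerSubgroup_inf_of_geomReduction_eq_zero (hp : p ≠ 2)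
    (hΔ : ¬ (p : ℤ) ∣ minimalDiscriminantInt W) (hord : ¬ (p : ℤ) ∣ W.frobeniusTrace p)
    (hκ : κ.IsCyclotomic) {𝔓 : Ideal (absIntegers (𝓞 ℚ) ℚ)}
    (hmem : ∀ x : absIntegers (𝓞 ℚ) ℚ, x ∈ 𝔓 ↔ (x : AlgebraicClosure ℚ) ∈ (placeOver p).nonunits)
    {v : HeightOneSpectrum (𝓞 ℚ)} (hv : (primesEquiv v : ℕ) = p) (h𝔓 : 𝔓 ∈ v.primesAbove)
    {c : geomPrimaryTorsion W p}
    (hcB : c ∈ FixedPoints.addSubgroup ↥(κ.kerSubgroup ⊓ 𝔓.decompositionSubgroup (absoluteGaloisGroup ℚ))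
      (geomPrimaryTorsion W p))
    (hcred : geomReduction hΔ ((c : geomPrimaryTorsion W p) : geomPoints W) = 0) : c = 0 := by
  letI : Module (ZMod p) (geomTorsion W p) := AddSubgroup.torsionBy.zmodModule
  have hpr : p.Prime := Fact.out
  have hp' : Odd p := hpr.eq_two_or_odd'.resolve_left hp
  set D : Subgroup (absoluteGaloisGroup ℚ) := 𝔓.decompositionSubgroup (absoluteGaloisGroup ℚ) with hD
  set B := FixedPoints.addSubgroup ↥(κ.kerSubgroup ⊓ D) (geomPrimaryTorsion W p) with hB
  set red := geomReduction (p := p) (W := W) hΔ with hred_def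
  -- the ordinary line `𝔽_p v₀` and an inertia element acting on it by `-1`
  obtain ⟨v₀, hv₀, hline⟩ := exists_line_of_not_dvd_frobeniusTrace p hΔ hord hmem
  obtain ⟨τ₀, hτ₀, hτ₀v⟩ :=
    W.exists_mem_inertia_smul_eq_of_sub_mem_line p hv h𝔓 hv₀ hline (-1)
  have hτ₀D : τ₀ ∈ D := Ideal.inertia_le_decompositionSubgroup _ _ hτ₀
  have hneg : τ₀ • v₀ = -v₀ := by rw [hτ₀v, Units.val_neg, Units.val_one, neg_one_smul]
  have hv₀p : (p : ℤ) • (v₀ : geomPoints W) = 0 := (Submodule.mem_torsionBy_iff _ _).mp v₀.2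
  have hv₀pn : p • (v₀ : geomPoints W) = 0 := by rw [← natCast_zsmul]; exact hv₀p
  have hnegc : τ₀ • (v₀ : geomPoints W) = -(v₀ : geomPoints W) := by
    rw [← AddSubgroup.torsionBy.coe_smul, hneg, NegMemClass.coe_neg]
  -- (i) `red v₀ = 0`
  have hredv₀ : red (v₀ : geomPoints W) = 0 := by
    refine eq_zero_of_two_nsmul_eq_zero_of_odd hp' ?_ ?_
    · have h := geomReduction_smul_of_mem_inertia hΔ hmem hτ₀ (v₀ : geomPoints W)
      rw [hnegc, map_neg, neg_eq_iff_add_eq_zero, ← two_nsmul] at h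
      exact h
    · rw [← map_nsmul, hv₀pn, map_zero]
  -- (ii) `ker(red) ∩ E[p] = ℤ v₀`
  have hker : ∀ x : geomPoints W, (p : ℤ) • x = 0 → red x = 0 →
      ∃ k : ℤ, k • (v₀ : geomPoints W) = x := by
    set f : geomTorsion W p →+ (reductionModPrime W p).geomPoints :=
      red.comp (geomTorsion W p).subtype with hf
    have hp0 : (p : AlgebraicClosure ℚ) ≠ 0 := Nat.cast_ne_zero.mpr hpr.ne_zero
    have hcard : Nat.card (geomTorsion W p) = p ^ 2 :=
      card_torsionPoints_eq_sq_holds W (AlgebraicClosure ℚ) (n := p) hp0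
    haveI : Finite (geomTorsion W p) :=
      Nat.finite_of_card_ne_zero (by rw [hcard]; exact pow_ne_zero _ hpr.ne_zero)
    have hf0 : ∃ x : geomTorsion W p, f x ≠ 0 := by
      obtain ⟨P, hP, hredP⟩ := exists_zsmul_eq_zero_geomReduction_ne_zero p hΔ hord
      exact ⟨⟨P, (Submodule.mem_torsionBy_iff _ _).mpr hP⟩, hredP⟩
    have hle : Nat.card f.ker ≤ p := card_ker_le_of_exists_ne_zero hcard f hf0
    have hv₀ker : v₀ ∈ f.ker := by rw [AddMonoidHom.mem_ker]; exact hredv₀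
    have hzle : AddSubgroup.zmultiples v₀ ≤ f.ker := AddSubgroup.zmultiples_le.mpr hv₀ker
    have hzcard : Nat.card (AddSubgroup.zmultiples v₀) = p := by
      rw [Nat.card_zmultiples, addOrderOf_eq_prime_of_ne_zero (ℓ := p) hv₀]
    have heq : AddSubgroup.zmultiples v₀ = f.ker :=
      AddSubgroup.eq_of_le_of_card_ge hzle (hle.trans hzcard.ge)
    intro x hpx hx
    have hxker : (⟨x, (Submodule.mem_torsionBy_iff _ _).mpr hpx⟩ : geomTorsion W p) ∈ f.ker := by
      rw [AddMonoidHom.mem_ker]; exact hx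
    rw [← heq, AddSubgroup.mem_zmultiples_iff] at hxker
    obtain ⟨k, hk⟩ := hxker
    exact ⟨k, by simpa only [AddSubgroupClass.coe_zsmul] using congrArg Subtype.val hk⟩
  -- (iii) `v₀`, as a point `m₀` of `E[p^∞]`, is not in `B`
  set m₀ : geomPrimaryTorsion W p := ⟨(v₀ : geomPoints W), 1, by rw [pow_one]; exact hv₀pn⟩
    with hm₀
  have hm₀ne : m₀ ≠ 0 := fun h ↦ hv₀ (Subtype.ext (congrArg (fun z : geomPrimaryTorsion W p ↦ (z : geomPoints W)) h))
  have hτ₀m₀ : τ₀ • m₀ = -m₀ := Subtype.ext hnegc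
  have hpm₀ : p • m₀ = 0 := Subtype.ext (by rw [AddSubmonoidClass.coe_nsmul]; exact hv₀pn)
  have hm₀B : m₀ ∉ B := by
    intro hm₀B
    -- `V = B[p]`, a finite `D`-stable subgroup
    set V : AddSubgroup (geomPrimaryTorsion W p) := B ⊓ (geomPrimaryTorsion W p)[(p : ℕ)] with hV
    have hfinp : Finite ↥((geomPrimaryTorsion W p)[(p : ℕ)]) := by
      have h := W.finite_torsionBy_geomPrimaryTorsion p 1
      rwa [pow_one] at h
    haveI hVfin : Finite V :=
      Finite.of_injective _ (AddSubgroup.inclusion_injective (inf_le_right : V ≤ _))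
    have hmemV : ∀ {w : geomPrimaryTorsion W p}, w ∈ V ↔ w ∈ B ∧ p • w = 0 := by
      intro w
      rw [hV, AddSubgroup.mem_inf, AddSubgroup.torsionBy.nsmul_iff]
    have hstab : ∀ (σ : D) (w : geomPrimaryTorsion W p), w ∈ V → (σ : absoluteGaloisGroup ℚ) • w ∈ V := by
      intro σ w hw
      rw [hmemV] at hw ⊢
      refine ⟨W.smul_mem_fixedPoints_kerSubgroup_inf κ σ.2 hw.1, ?_⟩
      rw [smul_comm, hw.2, smul_zero]
    let ρ : D →* Equiv.Perm V :=
      { toFun := fun σ ↦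
          { toFun := fun w ↦ ⟨(σ : absoluteGaloisGroup ℚ) • (w : geomPrimaryTorsion W p), hstab σ _ w.2⟩
            invFun := fun w ↦ ⟨(σ⁻¹ : D) • (w : geomPrimaryTorsion W p), hstab σ⁻¹ _ w.2⟩
            left_inv := fun w ↦ Subtype.ext (inv_smul_smul σ (w : geomPrimaryTorsion W p))
            right_inv := fun w ↦ Subtype.ext (smul_inv_smul σ (w : geomPrimaryTorsion W p)) }
        map_one' := Equiv.ext fun w ↦ Subtype.ext (one_smul _ (w : geomPrimaryTorsion W p))
        map_mul' := fun σ σ' ↦ Equiv.ext fun w ↦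
          Subtype.ext (mul_smul σ σ' (w : geomPrimaryTorsion W p)) }
    have hρ : ∀ (σ : D) (w : V),
        ((ρ σ w : V) : geomPrimaryTorsion W p) = (σ : absoluteGaloisGroup ℚ) • (w : geomPrimaryTorsion W p) :=
      fun _ _ ↦ rfl
    -- the exponent `d = pᵃ e` of the action
    haveI : Finite (Equiv.Perm V) := inferInstance
    set d : ℕ := Nat.card (Equiv.Perm V) with hd_def
    have hd : d ≠ 0 := Nat.card_pos.ne'
    obtain ⟨a, e, he, hde⟩ := Nat.exists_eq_pow_mul_and_not_dvd hd p hpr.ne_one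
    obtain ⟨u, hu⟩ := IwasawaDual.isUnit_natCast_padicInt (p := p) he
    have htriv : ∀ (σ : D) (w : V), ((σ : absoluteGaloisGroup ℚ) ^ d) • (w : geomPrimaryTorsion W p) = w := by
      intro σ w
      have h1 : ρ (σ ^ d) = 1 := by rw [map_pow, hd_def, pow_card_eq_one']
      have h2 := congrArg (fun π : Equiv.Perm V ↦ ((π w : V) : geomPrimaryTorsion W p)) h1
      simpa only [hρ, SubgroupClass.coe_pow, Equiv.Perm.coe_one, id_eq] using h2
    -- `g ∈ I_𝔓` with `κ g = e⁻¹ κ τ₀` (`κ(I_𝔓) = ℤ_p`): then `κ(g^d) = κ(τ₀^{pᵃ})`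
    obtain ⟨g, hgI, hκg⟩ := hκ.exists_mem_inertia_apply_eq hv h𝔓
      (Multiplicative.ofAdd (((u⁻¹ : ℤ_[p]ˣ) : ℤ_[p]) * (κ τ₀).toAdd))
    have hgD : g ∈ D := Ideal.inertia_le_decompositionSubgroup _ _ hgI
    have hκeq : (κ (g ^ d)).toAdd = (κ (τ₀ ^ p ^ a)).toAdd := by
      rw [map_pow, hκg, ← ofAdd_nsmul, toAdd_ofAdd, map_pow, toAdd_pow, nsmul_eq_mul, nsmul_eq_mul, hde,
        Nat.cast_mul, Nat.cast_pow, ← hu, mul_assoc, ← mul_assoc (u : ℤ_[p]), Units.mul_inv, one_mul]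
    have hmemK : (g ^ d)⁻¹ * τ₀ ^ p ^ a ∈ κ.kerSubgroup ⊓ D := by
      refine Subgroup.mem_inf.mpr ⟨?_, D.mul_mem (D.inv_mem (D.pow_mem hgD d)) (D.pow_mem hτ₀D _)⟩
      rw [ZpExtension.mem_kerSubgroup, map_mul, map_inv]
      apply Multiplicative.toAdd.injective
      rw [toAdd_mul, toAdd_inv, hκeq, toAdd_one, neg_add_cancel]
    -- `τ₀^{pᵃ}` acts trivially on `m₀ ∈ V` …
    have hm₀V : m₀ ∈ V := hmemV.mpr ⟨hm₀B, hpm₀⟩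
    have h1 : (τ₀ ^ p ^ a) • m₀ = m₀ := by
      have hfix := (FixedPoints.mem_addSubgroup _ _ _).mp hm₀B ⟨(g ^ d)⁻¹ * τ₀ ^ p ^ a, hmemK⟩
      rw [Subgroup.mk_smul] at hfix
      calc (τ₀ ^ p ^ a) • m₀ = (g ^ d) • (((g ^ d)⁻¹ * τ₀ ^ p ^ a) • m₀) := by
            rw [← mul_smul, mul_inv_cancel_left]
        _ = (g ^ d) • m₀ := by rw [hfix]
        _ = m₀ := htriv ⟨g, hgD⟩ ⟨m₀, hm₀V⟩
    -- … but `τ₀^k m₀ = (-1)^k m₀`, and `pᵃ` is odd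
    have h2 : ∀ k : ℕ, (τ₀ ^ k) • m₀ = ((-1 : ℤ) ^ k) • m₀ := by
      intro k
      induction k with
      | zero => rw [pow_zero, pow_zero, one_smul, one_zsmul]
      | succ k ih =>
        rw [pow_succ, mul_smul, hτ₀m₀, smul_neg, ih, pow_succ, mul_neg_one, neg_zsmul]
    have h3 : (τ₀ ^ p ^ a) • m₀ = -m₀ := by
      rw [h2, (hp'.pow).neg_one_pow, neg_one_zsmul]
    have h4 : 2 • m₀ = 0 := by
      rw [two_nsmul]
      exact eq_neg_iff_add_eq_zero.mp (h1.symm.trans h3)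
    exact hm₀ne (eq_zero_of_two_nsmul_eq_zero_of_odd hp' h4 hpm₀)
  -- (iv) `B ∩ ker(red) = 0`
  by_contra hc0
  obtain ⟨j, hne, hpj⟩ := W.exists_pow_smul_ne_zero_and_p_smul_eq_zero hc0
  set c' := p ^ j • c with hc'
  have hc'B : c' ∈ B := B.nsmul_mem hcB _
  have hc'red : red (c' : geomPoints W) = 0 := by
    rw [hc', AddSubmonoidClass.coe_nsmul, map_nsmul, hcred, smul_zero]
  have hc'p : (p : ℤ) • (c' : geomPoints W) = 0 := by
    rw [natCast_zsmul, ← AddSubmonoidClass.coe_nsmul, hpj, ZeroMemClass.coe_zero]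
  obtain ⟨k, hk⟩ := hker _ hc'p hc'red
  -- `p ∤ k`
  have hndvd : ¬ (p : ℤ) ∣ k := by
    rintro ⟨t, rfl⟩
    apply hne
    apply Subtype.ext
    rw [ZeroMemClass.coe_zero, ← hk, mul_comm, ← smul_smul, hv₀p, smul_zero]
  -- Bézout: `e k = 1 - a p`, so `e • c' = v₀` and `m₀ = e • c' ∈ B`
  have hirr : Irreducible (p : ℤ) := (Nat.prime_iff_prime_int.mp hpr).irreducible
  obtain ⟨a, e, hae⟩ := hirr.coprime_iff_not_dvd.mpr hndvd
  have hek : e * k = 1 + (-a) * p := by linear_combination hae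
  have hec : e • (c' : geomPoints W) = (v₀ : geomPoints W) := by
    rw [← hk, smul_smul, hek, add_zsmul, one_zsmul, ← smul_smul, hv₀p, smul_zero, add_zero]
  have hm₀eq : m₀ = e • c' := Subtype.ext (by rw [AddSubgroupClass.coe_zsmul, hec])
  exact hm₀B (hm₀eq ▸ B.zsmul_mem hc'B e)

/-! ## §3 `I_𝔓` and `D_𝔓` act trivially on `B_{D_𝔓}` -/

/-- **The inertia group acts trivially on `B_D = E[p^∞]^{ker κ ⊓ D_𝔓}`** (`κ` cyclotomic, `p` odd,
`p ∤ Δ_W`, `p ∤ a_p`, `𝔓` the place's prime): for `τ ∈ I_𝔓` and `b ∈ B_D`, `τ b − b ∈ B_D ∩ ker(red) = 0`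
(`red` is `I_𝔓`-invariant, `geomReduction_smul_of_mem_inertia`). [cite: GreenbergLNM1716, §1 p. 62; §3 p. 86]
[cite: Serre1972, §1.11 Prop. 11 and Cor.] -/
theorem smul_eq_of_mem_inertia_of_mem_fixedPoints_kerSubgroup_inf (hp : p ≠ 2)
    (hΔ : ¬ (p : ℤ) ∣ minimalDiscriminantInt W) (hord : ¬ (p : ℤ) ∣ W.frobeniusTrace p)
    (hκ : κ.IsCyclotomic) {𝔓 : Ideal (absIntegers (𝓞 ℚ) ℚ)}
    (hmem : ∀ x : absIntegers (𝓞 ℚ) ℚ, x ∈ 𝔓 ↔ (x : AlgebraicClosure ℚ) ∈ (placeOver p).nonunits)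
    {v : HeightOneSpectrum (𝓞 ℚ)} (hv : (primesEquiv v : ℕ) = p) (h𝔓 : 𝔓 ∈ v.primesAbove)
    {τ : absoluteGaloisGroup ℚ} (hτ : τ ∈ 𝔓.inertia (absoluteGaloisGroup ℚ))
    {b : geomPrimaryTorsion W p}
    (hb : b ∈ FixedPoints.addSubgroup ↥(κ.kerSubgroup ⊓ 𝔓.decompositionSubgroup (absoluteGaloisGroup ℚ))
      (geomPrimaryTorsion W p)) : τ • b = b := by
  have hτD : τ ∈ 𝔓.decompositionSubgroup (absoluteGaloisGroup ℚ) :=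
    Ideal.inertia_le_decompositionSubgroup _ _ hτ
  have hd : τ • b - b ∈ FixedPoints.addSubgroup
      ↥(κ.kerSubgroup ⊓ 𝔓.decompositionSubgroup (absoluteGaloisGroup ℚ)) (geomPrimaryTorsion W p) :=
    AddSubgroup.sub_mem _ (W.smul_mem_fixedPoints_kerSubgroup_inf κ hτD hb) hb
  have hdred : geomReduction hΔ ((τ • b - b : geomPrimaryTorsion W p) : geomPoints W) = 0 := by
    rw [AddSubgroupClass.coe_sub, map_sub, primaryComponent.coe_smul,
      geomReduction_smul_of_mem_inertia hΔ hmem hτ, sub_self]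
  exact sub_eq_zero.mp
    (W.eq_zero_of_mem_fixedPoints_kerSubgroup_inf_of_geomReduction_eq_zero κ hp hΔ hord hκ hmem hv h𝔓
      hd hdred)

/-- **All of `D_𝔓` acts trivially on `B_{D_𝔓}`** (`κ` cyclotomic, `p` odd good ordinary, the place's
prime): `σ ∈ D_𝔓` is `τ · (τ⁻¹σ)` with `τ ∈ I_𝔓`, `κ τ = κ σ` (`κ(I_𝔓) = ℤ_p`,
`ZpExtension.IsCyclotomic.exists_mem_inertia_apply_eq`) and `τ⁻¹σ ∈ ker κ ⊓ D_𝔓`. So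
`B_{D_𝔓} = E(ℚ_p)[p^∞] ∩ E[p^∞]^{…}`: the `p`-power torsion over `ℚ_{p,∞}` is already defined over
`ℚ_p`. [cite: GreenbergLNM1716, §1 p. 62; §3 p. 86] [cite: Washington1997, §13.1] -/
theorem smul_eq_of_mem_decompositionSubgroup_of_mem_fixedPoints_kerSubgroup_inf (hp : p ≠ 2)
    (hΔ : ¬ (p : ℤ) ∣ minimalDiscriminantInt W) (hord : ¬ (p : ℤ) ∣ W.frobeniusTrace p)
    (hκ : κ.IsCyclotomic) {𝔓 : Ideal (absIntegers (𝓞 ℚ) ℚ)}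
    (hmem : ∀ x : absIntegers (𝓞 ℚ) ℚ, x ∈ 𝔓 ↔ (x : AlgebraicClosure ℚ) ∈ (placeOver p).nonunits)
    {v : HeightOneSpectrum (𝓞 ℚ)} (hv : (primesEquiv v : ℕ) = p) (h𝔓 : 𝔓 ∈ v.primesAbove)
    {σ : absoluteGaloisGroup ℚ} (hσ : σ ∈ 𝔓.decompositionSubgroup (absoluteGaloisGroup ℚ))
    {b : geomPrimaryTorsion W p}
    (hb : b ∈ FixedPoints.addSubgroup ↥(κ.kerSubgroup ⊓ 𝔓.decompositionSubgroup (absoluteGaloisGroup ℚ))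
      (geomPrimaryTorsion W p)) : σ • b = b := by
  obtain ⟨τ, hτ, hκτ⟩ := hκ.exists_mem_inertia_apply_eq hv h𝔓 (κ σ)
  have hτD : τ ∈ 𝔓.decompositionSubgroup (absoluteGaloisGroup ℚ) :=
    Ideal.inertia_le_decompositionSubgroup _ _ hτ
  have hk : τ⁻¹ * σ ∈ κ.kerSubgroup ⊓ 𝔓.decompositionSubgroup (absoluteGaloisGroup ℚ) := by
    refine Subgroup.mem_inf.mpr ⟨?_, Subgroup.mul_mem _ (Subgroup.inv_mem _ hτD) hσ⟩
    rw [ZpExtension.mem_kerSubgroup, map_mul, map_inv, hκτ, inv_mul_cancel]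
  have h1 : (τ⁻¹ * σ) • b = b := by
    have h := (FixedPoints.mem_addSubgroup _ _ _).mp hb ⟨τ⁻¹ * σ, hk⟩
    rwa [Subgroup.mk_smul] at h
  calc σ • b = τ • ((τ⁻¹ * σ) • b) := by rw [← mul_smul, mul_inv_cancel_left]
    _ = τ • b := by rw [h1]
    _ = b := W.smul_eq_of_mem_inertia_of_mem_fixedPoints_kerSubgroup_inf κ hp hΔ hord hκ hmem hv h𝔓 hτ hb

/-! ## §4 Finiteness -/

/-- **`B_{D_𝔓}` is finite at the place's prime**: `red` is injective on it (§2) with values in the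
`p`-power-Frobenius-fixed points of `Ẽ(𝔽̄_p)` (`B_{D_𝔓}` is fixed by an arithmetic Frobenius
`σ ∈ D_𝔓`, `red (σ • P) = Frob_p • red P`, `geomReduction_smul_of_isArithFrobAt`), a finite set
(`finite_setOf_frobenius_smul_eq`: `Ẽ(𝔽_p)` is finite). [cite: GreenbergLNM1716, §1 p. 62; §3 p. 86]
[cite: Imai1975, Theorem (p. 12)] -/
theorem finite_fixedPoints_kerSubgroup_inf_decompositionSubgroup_placeOver (hp : p ≠ 2)
    (hΔ : ¬ (p : ℤ) ∣ minimalDiscriminantInt W) (hord : ¬ (p : ℤ) ∣ W.frobeniusTrace p)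
    (hκ : κ.IsCyclotomic) {𝔓 : Ideal (absIntegers (𝓞 ℚ) ℚ)}
    (hmem : ∀ x : absIntegers (𝓞 ℚ) ℚ, x ∈ 𝔓 ↔ (x : AlgebraicClosure ℚ) ∈ (placeOver p).nonunits)
    {v : HeightOneSpectrum (𝓞 ℚ)} (hv : (primesEquiv v : ℕ) = p) (h𝔓 : 𝔓 ∈ v.primesAbove) :
    Finite (FixedPoints.addSubgroup ↥(κ.kerSubgroup ⊓ 𝔓.decompositionSubgroup (absoluteGaloisGroup ℚ))
      (geomPrimaryTorsion W p)) := by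
  haveI : (reductionModPrime W p).IsElliptic := isElliptic_reductionModPrime W hΔ
  obtain ⟨φ, hφ⟩ := exists_frobenius_absoluteGaloisGroup (ZMod p)
  have hφp : ∀ x : AlgebraicClosure (ZMod p), φ • x = x ^ p := by
    intro x; rw [hφ x, Nat.card_zmod]
  obtain ⟨σ, hσ⟩ := HeightOneSpectrum.exists_isArithFrobAt_of_mem_primesAbove_holds (K := ℚ) (v := v) h𝔓
  haveI := h𝔓.1
  have hσD : σ ∈ 𝔓.decompositionSubgroup (absoluteGaloisGroup ℚ) := hσ.mem_stabilizer
  have hfin := (reductionModPrime W p).finite_setOf_frobenius_smul_eq hφ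
  set B := FixedPoints.addSubgroup ↥(κ.kerSubgroup ⊓ 𝔓.decompositionSubgroup (absoluteGaloisGroup ℚ))
    (geomPrimaryTorsion W p) with hB
  -- `red|_B` lands in the Frobenius-fixed points and is injective
  let f : B → {P : (reductionModPrime W p).geomPoints | φ • P = P} := fun b ↦
    ⟨geomReduction hΔ ((b : geomPrimaryTorsion W p) : geomPoints W), by
      rw [Set.mem_setOf_eq, ← geomReduction_smul_of_isArithFrobAt hΔ hmem hv h𝔓 hσ hφp,
        ← primaryComponent.coe_smul,
        W.smul_eq_of_mem_decompositionSubgroup_of_mem_fixedPoints_kerSubgroup_inf κ hp hΔ hord hκ hmem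
          hv h𝔓 hσD b.2]⟩
  haveI : Finite {P : (reductionModPrime W p).geomPoints | φ • P = P} := hfin.to_subtype
  refine Finite.of_injective f fun b₁ b₂ h ↦ ?_
  have h' : geomReduction hΔ (((b₁ : geomPrimaryTorsion W p) - b₂ : geomPrimaryTorsion W p) : geomPoints W) = 0 := by
    rw [AddSubgroupClass.coe_sub, map_sub, sub_eq_zero]
    exact congrArg Subtype.val h
  exact Subtype.ext (sub_eq_zero.mp
    (W.eq_zero_of_mem_fixedPoints_kerSubgroup_inf_of_geomReduction_eq_zero κ hp hΔ hord hκ hmem hv h𝔓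
      (B.sub_mem b₁.2 b₂.2) h'))

/-- **`E[p^∞]^{ker κ ⊓ D_𝔓}` is finite for EVERY prime `𝔓 ∣ p` of `\bar ℤ`** (`p` odd good ordinary,
`κ` cyclotomic): `𝔓 = g • 𝔓₁` for the place's prime `𝔓₁` (`exists_smul_eq_of_mem_primesAbove_holds`),
`D_{g•𝔓₁} = g D_{𝔓₁} g⁻¹` (`Ideal.decompositionSubgroup_smul`), and `b ↦ g⁻¹ • b` injects
`B_{D_𝔓}` into `B_{D_{𝔓₁}}` (`ker κ` is normal). [cite: GreenbergLNM1716, §1 p. 62; §3 p. 86]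
[cite: Imai1975, Theorem (p. 12)] -/
theorem finite_fixedPoints_kerSubgroup_inf_decompositionSubgroup_of_ordinary (hp : p ≠ 2)
    (hgood : W.HasGoodReductionAtPrime p) (hord : ¬ (p : ℤ) ∣ W.frobeniusTrace p)
    (hκ : κ.IsCyclotomic) {v : HeightOneSpectrum (𝓞 ℚ)} (hv : (primesEquiv v : ℕ) = p)
    {𝔓 : Ideal (absIntegers (𝓞 ℚ) ℚ)} (h𝔓 : 𝔓 ∈ v.primesAbove) :
    Finite (FixedPoints.addSubgroup ↥(κ.kerSubgroup ⊓ 𝔓.decompositionSubgroup (absoluteGaloisGroup ℚ))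
      (geomPrimaryTorsion W p)) := by
  have hΔ := W.not_dvd_minimalDiscriminantInt_of_hasGoodReductionAtPrime' p hgood
  obtain ⟨𝔓₁, hmem, h𝔓₁⟩ := exists_ideal_placeOver p hv
  haveI := W.finite_fixedPoints_kerSubgroup_inf_decompositionSubgroup_placeOver κ hp hΔ hord hκ hmem hv
    h𝔓₁
  obtain ⟨g, rfl⟩ := HeightOneSpectrum.exists_smul_eq_of_mem_primesAbove_holds (K := ℚ) (v := v) h𝔓₁ h𝔓
  set B₁ := FixedPoints.addSubgroup ↥(κ.kerSubgroup ⊓ 𝔓₁.decompositionSubgroup (absoluteGaloisGroup ℚ))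
    (geomPrimaryTorsion W p) with hB₁
  set B := FixedPoints.addSubgroup
    ↥(κ.kerSubgroup ⊓ (g • 𝔓₁).decompositionSubgroup (absoluteGaloisGroup ℚ)) (geomPrimaryTorsion W p)
    with hB
  -- `b ↦ g⁻¹ • b : B → B₁`
  have hmap : ∀ b ∈ B, g⁻¹ • b ∈ B₁ := by
    intro b hb
    rw [FixedPoints.mem_addSubgroup] at hb ⊢
    rintro ⟨δ, hδ⟩
    have hδK : δ ∈ κ.kerSubgroup := (Subgroup.mem_inf.mp hδ).1
    have hδD : δ ∈ 𝔓₁.decompositionSubgroup (absoluteGaloisGroup ℚ) := (Subgroup.mem_inf.mp hδ).2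
    have hconj : g * δ * g⁻¹ ∈ κ.kerSubgroup ⊓ (g • 𝔓₁).decompositionSubgroup (absoluteGaloisGroup ℚ) := by
      refine Subgroup.mem_inf.mpr ⟨?_, ?_⟩
      · rw [ZpExtension.mem_kerSubgroup] at hδK ⊢
        rw [map_mul, map_mul, map_inv, hδK, mul_one, mul_inv_cancel]
      · rw [Ideal.decompositionSubgroup_smul]
        exact Subgroup.smul_mem_pointwise_smul δ (MulAut.conj g) _ hδD
    have h := hb ⟨g * δ * g⁻¹, hconj⟩
    rw [Subgroup.mk_smul] at h ⊢
    calc δ • g⁻¹ • b = g⁻¹ • ((g * δ * g⁻¹) • b) := by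
          rw [mul_smul, mul_smul, inv_smul_smul]
      _ = g⁻¹ • b := by rw [h]
  refine Finite.of_injective (fun b : B ↦ (⟨g⁻¹ • (b : geomPrimaryTorsion W p), hmap b b.2⟩ : B₁))
    fun b₁ b₂ h ↦ ?_
  exact Subtype.ext (smul_left_cancel g⁻¹ (congrArg Subtype.val h))

/-- **Imai 1975 / Mazur Prop. 6.12, local form, at a good ordinary odd prime: `E(ℚ_{p,∞})[p^∞]` is
finite** — VERBATIM the hypothesis of `Kato2004.exists_iwasawaH2Data_fineSelmerDual_embedding`:
`Finite (FixedPoints.addSubgroup ↥(κ.kerSubgroup ⊓ GreenbergSelmer.decomp v) (W.geomPrimaryTorsion p))`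
for `E/ℚ` (globally minimal `W`), `p` odd with good ordinary reduction, `κ` the cyclotomic
`ℤ_p`-extension and `v` the place of `ℚ` at `p` (`decomp v` is the decomposition group of the prime
`adicCompletionPrime ℚ v ∣ p`, `decompositionSubgroup_adicCompletionPrime_eq_range`).
[cite: Imai1975, Theorem (p. 12)] [cite: GreenbergLNM1716, §1 p. 62; §3 p. 86] -/
theorem finite_fixedPoints_kerSubgroup_inf_decomp_of_ordinary (hp : p ≠ 2)
    (hgood : W.HasGoodReductionAtPrime p) (hord : ¬ (p : ℤ) ∣ W.frobeniusTrace p)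
    (hκ : κ.IsCyclotomic) (v : HeightOneSpectrum (𝓞 ℚ)) (hv : (primesEquiv v : ℕ) = p) :
    Finite (FixedPoints.addSubgroup ↥(κ.kerSubgroup ⊓ GreenbergSelmer.decomp v)
      (W.geomPrimaryTorsion p)) := by
  have h := W.finite_fixedPoints_kerSubgroup_inf_decompositionSubgroup_of_ordinary κ hp hgood hord hκ hv
    (adicCompletionPrime_mem_primesAbove ℚ v)
  rwa [decompositionSubgroup_adicCompletionPrime_eq_range] at h

end WeierstrassCurve

end
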